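import Summits.CriticalPhenomena.Ising3DConformalLimit.Theorems.RotationUpgradeFromTwoPoint.Negative.AutomaticOrders
import Summits.CriticalPhenomena.Ising3DConformalLimit.Theorems.GaussianScaleMixtureRotationUpgradeFromTwoPointNineMirrorRP
import Summits.CriticalPhenomena.Ising3DConformalLimit.Theorems.GaussianScaleMixtureRotationUpgradeFromTwoPointExteriorHarmonic
import Summits.CriticalPhenomena.Ising3DConformalLimit.Theorems.GaussianScaleMixtureRotationUpgradeFromTwoPointAnalyticOffFinite
import Summits.CriticalPhenomena.Ising3DConformalLimit.Theorems.GaussianScaleMixtureRotationUpgradeFromTwoPointEdgeBocherLiouville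
import Summits.CriticalPhenomena.Ising3DConformalLimit.Theorems.GaussianScaleMixtureRotationUpgradeFromTwoPointSigmaBoundReduction
import Summits.CriticalPhenomena.Ising3DConformalLimit.Theorems.GaussianScaleMixtureRotationUpgradeFromTwoPointUnitSigmaBound
import HarnessLib

/-!
# Crux `GaussianScaleMixture.RotationUpgradeFromTwoPoint` (stmt-CriticalPhenomena-8367) — PROVED
# (line `null-laplacian-edge-gaussianity`, closing file; leads 0, c1, c2)

The crux: every normalised, non-degenerate, translation-invariant, scale-covariant pointwise scaling limit `S` of the
critical `ℤ³` Ising correlators (`criticalCorr 3`, renormalisation `ρ > 0` on `(0,1]`) whose two-point kernel is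
invariant under all linear isometries is `IsRotationInvariant` (all orders, all of `O(3)`).

Proof (all ingredients are landed theorems of the tree; this file is glue only):
* GAUSSIAN locus `U₄ ≡ 0`: `isRotationInvariant_of_gaussian` (Negative/AutomaticOrders: Wick at all even orders of the
  round two-point function; Aizenman–Newman dichotomy).
* Otherwise `HasNontrivialU4 S`, and `Δ ∈ [1/2, 1]` (`delta_mem_Icc_of_hyp`).  Nine-mirror OS positivity of all orders
  (STUB 1 `stub_nineMirrorRP`) and the analyticity of `S_{m+1}(·, y)` off a finite set (STUB 3 `stub_analyticOffFinite`).
  The EDGE `Δ = 1/2` is excluded: there the round kernel is harmonic, every `S_{m+1}(·, y)` is harmonic where a lattice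
  mirror separates the variable from `y` (STUB 2 `stub_exteriorHarmonic`, an OS null vector), and flooding + removable
  singularities + GKS/Lebowitz + Liouville force `U₄ ≡ 0` (STUB 4 `stub_edgeBocherLiouville`) — contradiction.
* INTERIOR `1/2 < Δ ≤ 1`: the frame-`e₀` UNIT SIGMA BOUND `‖e^{-H} σ̂(y) e^{-H}‖ ≤ C₁` holds (STUB 5''
  `stub_interiorUnitSigmaBound`, the multiple-reflection bound of lead c2: symmetric insertion + Cauchy–Schwarz doubling +
  Newman's Gaussian domination + greedy hafnian bound, rate `max 1 (2K Σ (2ℓ)^{-2Δ}) < ∞` exactly when `Δ > 1/2`); the landed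
  `stub_axisSigmaBound_of_unit` (line `quarter-turn-liouville` of crux stmt-1980: scale covariance + contraction) makes it the
  two-sided axis sigma bound, and the GRAFT (STUB 6 `stub_sigmaBoundGraft`: the `quarter-turn-liouville` machinery —
  in-plane light cones, complex quarter-turn continuation, periodic Liouville, fourfold-to-full — with base level `n = 2`
  supplied by the two-point isotropy hypothesis) concludes `IsRotationInvariant S`.
-/

noncomputable section

open Literature.Probability.LatticeModels
open Literature.MathematicalPhysics.QuantumFieldTheory (axisReflection)
open Summit.CriticalPhenomena.Ising3DConformalLimit.RotationUpgradeFromTwoPointNegative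
  (isRotationInvariant_of_gaussian delta_mem_Icc_of_hyp)
open Summit.CriticalPhenomena.Ising3DConformalLimit.Cruxes.LimitRotationInvariant.QuarterTurnLiouville
  (LimitStructure stub_limitRegularity stub_axisSigmaBound_of_unit)

namespace Summit.CriticalPhenomena.Ising3DConformalLimit.Cruxes.RotationUpgradeFromTwoPoint.NullLaplacianEdgeGaussianity

/-- **Crux `RotationUpgradeFromTwoPoint` (item stmt-CriticalPhenomena-8367) — PROVED.**  Two-point isotropy upgrades to
`O(3)` invariance of every correlation function of a normalised, non-degenerate, translation-invariant, scale-covariant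
pointwise scaling limit of the critical `ℤ³` Ising correlators.  Glue over the six landed stubs of line
`null-laplacian-edge-gaussianity` (see the module docstring). -/
theorem rotationUpgradeFromTwoPoint_proof :
    Summit.CriticalPhenomena.Ising3DConformalLimit.Theses.GaussianScaleMixture.RotationUpgradeFromTwoPoint := by
  intro ρ Δ S hρ hlim hnorm hnd htr hsc hiso
  by_cases hU4 : HasNontrivialU4 S
  · -- the non-Gaussian branch
    have hwin : Δ ∈ Set.Icc (1 / 2 : ℝ) 1 := delta_mem_Icc_of_hyp hρ hlim hnd hsc
    have hRP := stub_nineMirrorRP ρ S hρ hlim hnorm htr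
    have han := stub_analyticOffFinite ρ Δ S hρ hlim hnorm hnd htr hsc hRP
    -- the edge `Δ = 1/2` is Gaussian, hence excluded
    have hlt : 1 / 2 < Δ := by
      rcases eq_or_lt_of_le hwin.1 with heq | hlt
      · exfalso
        obtain ⟨z, hz, hne⟩ := hU4
        refine hne (stub_edgeBocherLiouville ρ Δ S hρ hlim hnorm hnd htr hsc hiso heq.symm
          (fun y hy => stub_exteriorHarmonic ρ Δ S hρ hlim hnorm hnd htr hsc hiso hRP heq.symm 3 y hy)
          (fun y hy => han 3 y hy) z hz)
      · exact hlt
    -- the interior: unit sigma bound ⇒ axis sigma bound ⇒ graft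
    have hunit := stub_interiorUnitSigmaBound ρ Δ S hρ hlim hnorm hnd htr hsc hiso hlt hwin.2 hU4 hRP han
    have hH : Cruxes.LimitRotationInvariant.QuarterTurnLiouville.CruxHyp ρ Δ S := ⟨hρ, hlim, hnorm, hnd, htr, hsc⟩
    have hL : LimitStructure Δ S :=
      ⟨stub_limitRegularity ρ Δ S hH, Cruxes.LimitRotationInvariant.QuarterTurnLiouville.stub_nineMirrorRP ρ Δ S hH⟩
    exact stub_sigmaBoundGraft ρ Δ S hρ hlim hnorm hnd htr hsc hiso (stub_axisSigmaBound_of_unit Δ S hL hunit)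
  · -- the Gaussian locus: Wick at every even order
    have hU : ∀ z ∈ NonCoincident 3 4, limitConnectedFour S z = 0 := by
      intro z hz
      by_contra hne
      exact hU4 ⟨z, hz, hne⟩
    exact isRotationInvariant_of_gaussian hlim hnorm htr hiso hU

/-- The skeleton's name for the same theorem (the registered composition `RotationUpgradeFromTwoPoint_of` of
`Lines/null_laplacian_edge_gaussianity.lean`, now sorry-free). -/
theorem RotationUpgradeFromTwoPoint_of :
    Summit.CriticalPhenomena.Ising3DConformalLimit.Theses.GaussianScaleMixture.RotationUpgradeFromTwoPoint :=
  rotationUpgradeFromTwoPoint_proof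

end Summit.CriticalPhenomena.Ising3DConformalLimit.Cruxes.RotationUpgradeFromTwoPoint.NullLaplacianEdgeGaussianity

end
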